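import Literature.NumberTheory.EllipticCurves.AbelianVarietyBridge
import Literature.NumberTheory.EllipticCurves.WeierstrassChartPoints
import Literature.AlgebraicGeometry.Motives.AlgPointsSeparate
import HarnessLib

/-!
# Abelian-variety models of a Weierstrass curve, I: the structure and its points

The named facts `WeierstrassCurve.nonempty_abelianVarietyBridge{,_symm,Full}` ask for an
abelian variety `A/K` whose `K̄`-points are those of the elliptic curve `W` and whose non-zero
`K`-homomorphisms are isogenies on points (Silverman, *AEC* III.3.1(c), III.3.6, III.4.8,
III.4.9). Whatever the construction of `A` (the plane cubic `V₊(F) ⊂ ℙ²_K` of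
`WeierstrassScheme`, or two glued affine charts), the "homomorphisms are isogenies" half only
uses a small interface, isolated here as the predicate `WeierstrassCurve.IsAbelianVarietyModel W A c e`
on a triple `(A, c, e)`:

* an abelian variety `A` over `K`;
* an open immersion `chart : Spec K[W] → A` over `K` of Mathlib's affine Weierstrass curve
  (the chart `Z ≠ 0`; AEC III.1);
* a `Γ_K`-equivariant identification `e : A(K̄) ≃+ E(K̄) = W.geomPoints` which on the chart is
  "take coordinates": the `K̄`-point `Spec K̄ → Spec K[W] → A` with coordinates `(x, y)` is sent
  to the affine point `(x, y)` (`e_chartPoint`).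

From these data this file derives: the transported homomorphism on points
`pointsHom f = e' ∘ f(K̄) ∘ e⁻¹ : E(K̄) →+ E'(K̄)` of a `K`-homomorphism `f : A → A'`
(`pointsHom_smul`: `Γ_K`-equivariant), that `pointsHom f ≠ 0` when `f ≠ 0`
(`pointsHom_ne_zero`, by faithfulness of `A ↦ A(K̄)`, `AlgPointsSeparate`), that an affine
point with affine image lies in the open `V_f = chart⁻¹ f⁻¹(chart'(Spec K[W'])) ⊆ Spec K[W]`
(`mem_V_of_pointsHom_eq_some`), and hence that for `f ≠ 0` this open contains a non-empty basic
open `D(r)`, `r ≠ 0` (`exists_basicOpen_le_V`) — the open set on which `f` will be read off as a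
rational map in the sequel (`AbelianVarietyModelIsogeny`), giving
`AbelianVarietyBridge`s and the facts above for any pair of models.

## References

* [SilvermanAEC2009] J. H. Silverman, *The Arithmetic of Elliptic Curves*, 2nd ed., GTM 106,
  Springer 2009: III.1, III.3.1(c), III.3.6, III.4 (Def.), III.4.8, III.4.9.
* [MumfordAV1970] D. Mumford, *Abelian Varieties*, §4 (homomorphisms and points).

## Design

`IsAbelianVarietyModel A c e` is a `Prop`-valued hypothesis structure on the data
`(A, c, e)` (CONVENTIONS: data + the properties consumed), deliberately minimal so that any
construction of the elliptic curve as a `K`-group scheme instantiates it; it introduces no named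
fact. (It is a predicate on parameters rather than a structure bundling `A, c, e` as fields:
a `structure` field of type `Spec K[W] ⟶ _` makes Lean's structure elaborator time out.)
`namespace WeierstrassCurve` (dot-notation extensions, as the sibling preludes).
-/

noncomputable section

open CategoryTheory AlgebraicGeometry
open Literature.AlgebraicGeometry.Motives

universe u

namespace WeierstrassCurve

variable {K : Type u} [Field K]

/-! ## `K`-algebra homomorphisms from morphisms of spectra over `K` -/

section SpecAlgHom

variable {A L : Type u} [CommRing A] [CommRing L] [Algebra K A] [Algebra K L]

/-- A morphism `Spec L → Spec A` compatible with the `K`-algebra structure maps is `Spec` of a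
`K`-algebra homomorphism `A → L` (`Spec` is fully faithful). [folklore] -/
def algHomOfSpecMap (g : Spec (CommRingCat.of L) ⟶ Spec (CommRingCat.of A))
    (hg : g ≫ Spec.map (CommRingCat.ofHom (algebraMap K A)) =
      Spec.map (CommRingCat.ofHom (algebraMap K L))) : A →ₐ[K] L where
  toRingHom := (Spec.preimage g).hom
  commutes' r := by
    have h : CommRingCat.ofHom (algebraMap K A) ≫ Spec.preimage g =
        CommRingCat.ofHom (algebraMap K L) :=
      Spec.map_injective ((Spec.map_comp _ _).trans
        ((congrArg (· ≫ Spec.map (CommRingCat.ofHom (algebraMap K A))) (Spec.map_preimage g)).trans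
          hg))
    exact congrArg (fun φ : CommRingCat.of K ⟶ CommRingCat.of L ↦ φ.hom r) h

/-- `Spec` of `algHomOfSpecMap g` is `g`. [folklore] -/
@[simp]
theorem specMap_algHomOfSpecMap (g : Spec (CommRingCat.of L) ⟶ Spec (CommRingCat.of A))
    (hg : g ≫ Spec.map (CommRingCat.ofHom (algebraMap K A)) =
      Spec.map (CommRingCat.ofHom (algebraMap K L))) :
    Spec.map (CommRingCat.ofHom (algHomOfSpecMap g hg).toRingHom) = g :=
  Spec.map_preimage g

end SpecAlgHom

variable (W : WeierstrassCurve K)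

/-! ## Points of a `K`-scheme through the affine chart -/

section ChartPoint

variable {X : SchemeOver K} (c : Spec (CommRingCat.of W.toAffine.CoordinateRing) ⟶ X.left)
  (hc : c ≫ X.hom = Spec.map (CommRingCat.ofHom (algebraMap K W.toAffine.CoordinateRing)))
  {L : Type u} [Field L] [Algebra K L]

/-- The `L`-valued point of a `K`-scheme `X` with coordinates `(x, y)` through a chart
`c : Spec K[W] → X`: `Spec L → Spec K[W] → X`, the first map being evaluation at the solution
`(x, y)` of the Weierstrass equation (Silverman, *AEC* III.1). [cite: SilvermanAEC2009, III.1] -/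
def chartPoint (x y : L) (h : (W.baseChange L).toAffine.Equation x y) : AlgPoints X L :=
  Over.homMk (Spec.map (CommRingCat.ofHom (W.affineEval x y h).toRingHom) ≫ c) <| by
    change (Spec.map (CommRingCat.ofHom (W.affineEval x y h).toRingHom) ≫ c) ≫ X.hom =
      Spec.map (CommRingCat.ofHom (algebraMap K L))
    rw [Category.assoc, hc, ← Spec.map_comp, ← CommRingCat.ofHom_comp, AlgHom.toRingHom_eq_coe,
      AlgHom.comp_algebraMap]

/-- Underlying morphism of `chartPoint`. [folklore] -/
@[simp]
theorem chartPoint_left (x y : L) (h : (W.baseChange L).toAffine.Equation x y) :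
    (W.chartPoint c hc x y h).left =
      Spec.map (CommRingCat.ofHom (W.affineEval x y h).toRingHom) ≫ c := rfl

/-- **The Galois action on chart points is coordinatewise**: `σ • (x, y) = (σ x, σ y)`
(Silverman, *AEC* I.2; `σ • P = Spec σ ≫ P`). [cite: SilvermanAEC2009, I.2] -/
theorem smul_chartPoint (σ : L ≃ₐ[K] L) (x y : L) (h : (W.baseChange L).toAffine.Equation x y)
    (h' : (W.baseChange L).toAffine.Equation (σ x) (σ y)) :
    σ • W.chartPoint c hc x y h = W.chartPoint c hc (σ x) (σ y) h' := by
  ext : 1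
  rw [AlgPoints.smul_left, chartPoint_left, chartPoint_left, ← Category.assoc, ← Spec.map_comp,
    ← CommRingCat.ofHom_comp]
  have e : (σ : L →ₐ[K] L).comp (W.affineEval x y h) = W.affineEval (σ x) (σ y) h' :=
    W.affine_algHom_ext (by rw [AlgHom.comp_apply, affineEval_xClass, affineEval_xClass]; rfl)
      (by rw [AlgHom.comp_apply, affineEval_yClass, affineEval_yClass]; rfl)
  rw [AlgHom.toRingHom_eq_coe, AlgHom.toRingHom_eq_coe, ← e, AlgHom.comp_toRingHom]
  rfl

end ChartPoint

/-! ## The predicate -/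

/-- **`(A, c, e)` is an abelian-variety model of the Weierstrass curve `W` over `K`**: `A/K` is an
abelian variety, `c : Spec K[W] ↪ A` an open immersion over `K` of the affine chart (the open
`Z ≠ 0` of the plane cubic, Silverman, *AEC* III.1), and `e : A(K̄) ≃+ E(K̄)` a `Γ_K`-equivariant
identification of geometric points under which the `K̄`-point of `A` through the chart with
coordinates `(x, y)` is the affine point `(x, y)` (AEC III.2: the group law of `E` is the
chord–tangent law on these points). The smooth plane cubic with its group law is such a model
(AEC III.3.1(c), III.3.6); the predicate records exactly what the "homomorphisms are
isogenies" dictionary (AEC III.4.8–4.9) uses. [cite: SilvermanAEC2009, III.3.1(c)] -/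
structure IsAbelianVarietyModel (A : AbelianVariety K)
    (c : Spec (CommRingCat.of W.toAffine.CoordinateRing) ⟶ A.X.left)
    (e : A.geomPoints ≃+ W.geomPoints) : Prop where
  /-- The chart is an open immersion. -/
  isOpenImmersion_chart : IsOpenImmersion c
  /-- The chart is a morphism of `K`-schemes. -/
  chart_over : c ≫ A.X.hom = Spec.map (CommRingCat.ofHom (algebraMap K W.toAffine.CoordinateRing))
  /-- `e` commutes with `Γ_K`. -/
  e_smul : ∀ (σ : Field.absoluteGaloisGroup K) (P : A.geomPoints), e (σ • P) = σ • e P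
  /-- On the chart, `e⁻¹` is "the point with these coordinates". -/
  e_symm_some : ∀ (x y : AlgebraicClosure K)
    (h : (W.baseChange (AlgebraicClosure K)).toAffine.Nonsingular x y),
    e.symm (Affine.Point.some x y h) =
      (Additive.ofMul (W.chartPoint (X := A.X) c chart_over x y h.left) : A.geomPoints)

namespace IsAbelianVarietyModel

variable {W} {A : AbelianVariety K} {c : Spec (CommRingCat.of W.toAffine.CoordinateRing) ⟶ A.X.left}
  {e : A.geomPoints ≃+ W.geomPoints} (hM : W.IsAbelianVarietyModel A c e)
  {W' : WeierstrassCurve K} {A' : AbelianVariety K}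
  {c' : Spec (CommRingCat.of W'.toAffine.CoordinateRing) ⟶ A'.X.left}
  {e' : A'.geomPoints ≃+ W'.geomPoints} (hM' : W'.IsAbelianVarietyModel A' c' e')

local notation "K̄" => AlgebraicClosure K

include hM in
/-- `e (x, y) = (x, y)`: on the chart `e` is "take coordinates". [cite: SilvermanAEC2009, III.1] -/
theorem e_chartPoint (x y : K̄) (h : (W.baseChange K̄).toAffine.Nonsingular x y) :
    e (Additive.ofMul (W.chartPoint (X := A.X) c hM.chart_over x y h.left)) =
      (Affine.Point.some x y h : W.geomPoints) := by
  rw [← hM.e_symm_some x y h, AddEquiv.apply_symm_apply]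

include hM in
/-- The inverse identification commutes with `Γ_K`. [folklore] -/
theorem e_symm_smul (σ : Field.absoluteGaloisGroup K) (Q : W.geomPoints) :
    e.symm (σ • Q) = σ • e.symm Q := by
  apply e.injective
  rw [hM.e_smul, e.apply_symm_apply, e.apply_symm_apply]

end IsAbelianVarietyModel

/-! ## The homomorphism on points induced by a homomorphism of models -/

section PointsHom

variable {W} {A : AbelianVariety K} (e : A.geomPoints ≃+ W.geomPoints)
  {W' : WeierstrassCurve K} {A' : AbelianVariety K} (e' : A'.geomPoints ≃+ W'.geomPoints)
  (f : A ⟶ A')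

local notation "K̄" => AlgebraicClosure K

/-- **The map on points of a `K`-homomorphism `f : A → A'`, transported to the curves along
identifications `e, e'`**: `e' ∘ f(K̄) ∘ e⁻¹ : E(K̄) →+ E'(K̄)` (Silverman, *AEC* III.4.8: on
points an isogeny is a group homomorphism — here by construction). [cite: SilvermanAEC2009, III.4.8] -/
def pointsHom : W.geomPoints →+ W'.geomPoints :=
  (e' : A'.geomPoints →+ W'.geomPoints).comp
    ((AbelianVariety.Hom.geomPointsMap f).comp (e.symm : W.geomPoints →+ A.geomPoints))

/-- Unfolding `pointsHom`. [folklore] -/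
theorem pointsHom_apply (Q : W.geomPoints) :
    pointsHom e e' f Q = e' (AbelianVariety.Hom.geomPointsMap f (e.symm Q)) := rfl

/-- `pointsHom f ∘ e = e' ∘ f(K̄)`. [folklore] -/
@[simp]
theorem pointsHom_e (P : A.geomPoints) :
    pointsHom e e' f (e P) = e' (AbelianVariety.Hom.geomPointsMap f P) := by
  rw [pointsHom_apply, e.symm_apply_apply]

/-- **A non-zero homomorphism is non-zero on transported points** (faithfulness of `A ↦ A(K̄)`,
`AbelianVariety.exists_geomPointsMap_ne_zero`). [cite: MumfordAV1970, §4] -/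
theorem pointsHom_ne_zero (hf : f ≠ 0) : pointsHom e e' f ≠ 0 := by
  obtain ⟨P, hP⟩ := AbelianVariety.exists_geomPointsMap_ne_zero hf
  intro h0
  have h1 := DFunLike.congr_fun h0 (e P)
  rw [pointsHom_e, AddMonoidHom.zero_apply, map_eq_zero_iff _ e'.injective] at h1
  exact hP h1

/-- Under a non-zero homomorphism some affine point has affine (non-zero) image on transported
points. [cite: SilvermanAEC2009, III.4.8] -/
theorem exists_pointsHom_some_eq_some (hf : f ≠ 0) :
    ∃ (x y : K̄) (h : (W.baseChange K̄).toAffine.Nonsingular x y) (x' y' : K̄)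
      (h' : (W'.baseChange K̄).toAffine.Nonsingular x' y'),
      pointsHom e e' f (Affine.Point.some x y h) = Affine.Point.some x' y' h' := by
  have hne := pointsHom_ne_zero e e' f hf
  obtain ⟨Q, hQ⟩ : ∃ Q : W.geomPoints, pointsHom e e' f Q ≠ 0 := by
    by_contra h
    push Not at h
    exact hne (AddMonoidHom.ext h)
  rcases Q with _ | ⟨x, y, h⟩
  · exact (hQ (by change pointsHom e e' f 0 = 0; exact map_zero _)).elim
  · generalize hR : pointsHom e e' f (Affine.Point.some x y h) = R at hQ
    rcases R with _ | ⟨x', y', h'⟩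
    · exact (hQ rfl).elim
    · exact ⟨x, y, h, x', y', h', hR⟩

end PointsHom

namespace IsAbelianVarietyModel

variable {W} {A : AbelianVariety K} {c : Spec (CommRingCat.of W.toAffine.CoordinateRing) ⟶ A.X.left}
  {e : A.geomPoints ≃+ W.geomPoints} (hM : W.IsAbelianVarietyModel A c e)
  {W' : WeierstrassCurve K} {A' : AbelianVariety K}
  {c' : Spec (CommRingCat.of W'.toAffine.CoordinateRing) ⟶ A'.X.left}
  {e' : A'.geomPoints ≃+ W'.geomPoints} (hM' : W'.IsAbelianVarietyModel A' c' e')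
  (f : A ⟶ A')

local notation "K̄" => AlgebraicClosure K

include hM hM' in
/-- **`pointsHom f` commutes with `Γ_K`** (`f` is defined over `K`: `geomPointsMap_smul`, and
`e, e'` are equivariant). [cite: SilvermanAEC2009, III.4.8] -/
theorem pointsHom_smul (σ : Field.absoluteGaloisGroup K) (Q : W.geomPoints) :
    pointsHom e e' f (σ • Q) = σ • pointsHom e e' f Q := by
  rw [pointsHom_apply, pointsHom_apply, hM.e_symm_smul, AbelianVariety.Hom.geomPointsMap_smul,
    hM'.e_smul]

/-! ### The open set where `f` maps the chart into the chart -/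

/-- The open `V_f = c⁻¹ (f⁻¹ (c' (Spec K[W']))) ⊆ Spec K[W]` of the affine chart of `W` mapped by
`f` into the affine chart of `W'` (as a set of points of `Spec K[W]`). [folklore] -/
def V (c : Spec (CommRingCat.of W.toAffine.CoordinateRing) ⟶ A.X.left)
    (c' : Spec (CommRingCat.of W'.toAffine.CoordinateRing) ⟶ A'.X.left) (f : A ⟶ A') :
    Set (Spec (CommRingCat.of W.toAffine.CoordinateRing)) :=
  (c ≫ AbelianVariety.Hom.toSchemeHom f) ⁻¹' Set.range c'

/-- Membership in `V_f`. [folklore] -/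
theorem mem_V_iff (p : Spec (CommRingCat.of W.toAffine.CoordinateRing)) :
    p ∈ V c c' f ↔ (c ≫ AbelianVariety.Hom.toSchemeHom f) p ∈ Set.range c' := Iff.rfl

include hM' in
/-- `V_f` is open (`c'` is an open immersion). [folklore] -/
theorem isOpen_V : IsOpen (V c c' f) :=
  haveI := hM'.isOpenImmersion_chart
  c'.isOpenEmbedding.isOpen_range.preimage (c ≫ AbelianVariety.Hom.toSchemeHom f).continuous

/-- The point of `Spec K[W]` underlying the affine `K̄`-point `(x, y)`. [folklore] -/
abbrev specPt (x y : K̄) (h : (W.baseChange K̄).toAffine.Equation x y) :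
    Spec (CommRingCat.of W.toAffine.CoordinateRing) :=
  Spec.map (CommRingCat.ofHom (W.affineEval x y h).toRingHom) (IsLocalRing.closedPoint K̄)

include hM hM' in
/-- **If `pointsHom f (x, y) = (x', y')` then `f` maps the chart point `(x, y)` of `A` to the
chart point `(x', y')` of `A'`.** [cite: SilvermanAEC2009, III.4.8] -/
theorem chartPoint_comp_eq_of_pointsHom_eq_some {x y : K̄}
    {h : (W.baseChange K̄).toAffine.Nonsingular x y}
    {x' y' : K̄} {h' : (W'.baseChange K̄).toAffine.Nonsingular x' y'}
    (he : pointsHom e e' f (Affine.Point.some x y h) = Affine.Point.some x' y' h') :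
    W.chartPoint (X := A.X) c hM.chart_over x y h.left ≫ f.hom.hom.hom =
      W'.chartPoint (X := A'.X) c' hM'.chart_over x' y' h'.left := by
  have h1 : AbelianVariety.Hom.geomPointsMap f
      (Additive.ofMul (W.chartPoint (X := A.X) c hM.chart_over x y h.left)) =
      e'.symm (Affine.Point.some x' y' h') := by
    rw [← he, pointsHom_apply, e'.symm_apply_apply, hM.e_symm_some]
  rw [hM'.e_symm_some, AbelianVariety.Hom.geomPointsMap_ofMul] at h1
  exact Additive.ofMul.injective h1

include hM hM' in
/-- If `pointsHom f (x, y)` is an affine point then the point of `Spec K[W]` under `(x, y)` lies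
in `V_f`. [cite: SilvermanAEC2009, III.4.8] -/
theorem mem_V_of_pointsHom_eq_some {x y : K̄} {h : (W.baseChange K̄).toAffine.Nonsingular x y}
    {x' y' : K̄} {h' : (W'.baseChange K̄).toAffine.Nonsingular x' y'}
    (he : pointsHom e e' f (Affine.Point.some x y h) = Affine.Point.some x' y' h') :
    specPt x y h.left ∈ V c c' f := by
  have h1 := congrArg CommaMorphism.left (hM.chartPoint_comp_eq_of_pointsHom_eq_some hM' f he)
  change (Spec.map _ ≫ c) ≫ AbelianVariety.Hom.toSchemeHom f = Spec.map _ ≫ c' at h1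
  rw [mem_V_iff, specPt, ← Scheme.Hom.comp_apply, ← Category.assoc, h1, Scheme.Hom.comp_apply]
  exact ⟨_, rfl⟩

include hM hM' in
/-- **For `f ≠ 0` the open `V_f` contains a non-empty basic open `D(r)`, `r ≠ 0`** (a point of
`V_f` exists by the previous lemmas, and the `D(r)` form a basis). [cite: SilvermanAEC2009, III.4.8] -/
theorem exists_basicOpen_le_V (hf : f ≠ 0) : ∃ r : W.toAffine.CoordinateRing, r ≠ 0 ∧
    ((PrimeSpectrum.basicOpen r : Set (PrimeSpectrum W.toAffine.CoordinateRing)) ⊆ V c c' f) := by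
  obtain ⟨x, y, h, x', y', h', he⟩ := exists_pointsHom_some_eq_some e e' f hf
  have hp := hM.mem_V_of_pointsHom_eq_some hM' f he
  obtain ⟨U, ⟨r, rfl⟩, hpr, hrV⟩ :=
    PrimeSpectrum.isTopologicalBasis_basic_opens.exists_subset_of_mem_open hp (isOpen_V hM' f)
  refine ⟨r, fun hr ↦ ?_, hrV⟩
  subst hr
  exact (PrimeSpectrum.mem_basicOpen _ _).mp hpr (Ideal.zero_mem _)

end IsAbelianVarietyModel

end WeierstrassCurve
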